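/-
Origin: expansion seat `planner-pub-hodgecm-landherr-g9-0`, handover #2 2026-08-18T07:56:36Z (`HOME/pub-hodgecm-landherr-g9/lean/LandherrG9/HermSpace3Godement.lean`, md5 98666303, 246 lines);
landed by the gen-7 packager in gate run 26 as `HodgeCM/Proofs/LandherrGodement.lean` (import ^import LandherrG9\.HermSpace3Isotropy\b→import HodgeCM.Proofs.LandherrIsotropy ×1).
-/
/-
Copyright: pub-hodgecm formalisation cell (harness21, 2026). New file (not vendored).
Origin: HOME/pub-hodgecm-landherr-g9/lean/LandherrG9/HermSpace3Godement.lean — session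
planner-pub-hodgecm-landherr-g9-0 (unit pub-hodgecm-landherr-g9, EXPANSION part (c) `Lemma33bLandherr`, gen 9).
Intended final place: `HodgeCM/Proofs/LandherrGodement.lean` (additive leaf; imports the landed
`HodgeCM.PerL34.GodementBridge` (run 21) and `HodgeCM.Proofs.LandherrIsotropy` (= this seat's
`LandherrG9/HermSpace3Isotropy.lean`, to land first); nothing in the package depends on it).
-/
import Summits.HodgeConjecture.HodgeCM.Proofs.LandherrIsotropy
import Summits.HodgeConjecture.HodgeCM.PerL34.GodementBridge

set_option autoImplicit false

/-!
# `G_U = U(V₃, h)` is anisotropic in Godement's sense — the dictionary `HermSpace3` ↔ pv05's `Sesq` / `isom`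

PerL v5 ll. 68–69: "`G_U` is anisotropic and `[G_U] := G_U(L₀)\G_U(𝔸_{L₀})` is compact".  The package holds the two
halves of this sentence in two languages that had not been joined:

* pv05's KERNEL theorem `PerL34.Doubling.eq_one_of_unipotent` (`PerL34/Anisotropic.lean`, run 20): for a
  sesquilinear form `h : Sesq L W` (Mathlib convention, `L` any field with a `StarRing` structure) that is
  `Anisotropic` (`h(w,w) = 0 ⇒ w = 0`), the isometry group `isom h` has no unipotent element `≠ 1` — Godement's wording
  of "anisotropic" in Sém. Bourbaki 257 §5 Thm 4 (`GodementDatum`, `PerL34/GodementBridge.lean`: `compact_of_godement`);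
* PerL's ACTUAL `G_U`: the unitary group `unitaryGroup (conjRingHomK L) V.Hm ≤ GL₃(L)` of a `V : HermSpace3 L ι₁`
  (`CM/Basic.lean`; this is the group in which `Level V` lives), a Gram MATRIX over the bundled CM field `L`, for
  which `Proofs/LandherrIsotropy.lean` (gen 9) proves: `h` is anisotropic iff `[L:ℚ] ≠ 2`.

This file is the dictionary ("the instantiating seat's dictionary" of `PerL34/Anisotropic.lean`'s docstring) and
the composition:

* §1 `CMField.instStarRing` — complex conjugation `conjRingHomK L` as the `star` of the CM field `L` (a SCOPED
  instance: `open HodgeCM.CMField` to use it), so that pv05's `Sesq L W = W →ₗ⋆[L] W →ₗ[L] L` makes sense over `L`;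
* §2 `HermSpace3.sesq V : Sesq L (Fin 3 → L)` — PerL's `h` as a Mathlib sesquilinear form, `V.sesq x y = ⟪x, y⟫_{Hm}`
  (`sesq_apply`); `anisotropic_sesq_iff` : `Anisotropic V.sesq ↔ [L:ℚ] ≠ 2`;
* §3 `glEquiv L n : GL n L ≃* ((n → L) ≃ₗ[L] (n → L))` (Mathlib's `GeneralLinearGroup.toLin`), `glEquiv_apply`
  (`g ↦ (x ↦ g x)`), `hermForm_injective` (a Gram matrix is determined by its form), and the identification of the
  two unitary groups **`mem_isom_sesq_iff`** : `glEquiv g ∈ isom V.sesq ↔ g ∈ unitaryGroup σ V.Hm`,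
  `isom_sesq_eq_map`, **`unitaryGroupEquivIsom V : unitaryGroup σ V.Hm ≃* isom V.sesq`**;
* §4 the composition: **`HermSpace3.godement_anisotropic`** — for `[L:ℚ] ≠ 2` Godement's anisotropy condition HOLDS
  (kernel) for `U(V₃,h)(L₀) = isom V.sesq`; `compact_of_godement_thm4` — so the PRINT theorem (Godement Thm 4, a
  HYPOTHESIS `Godement_Thm4` of the datum, never asserted) yields the consumer's compactness proposition; and in the
  package's native matrix language **`HermSpace3.eq_one_of_unipotent`**: every `g ∈ unitaryGroup σ V.Hm` with `g − 1`
  nilpotent is `1`, in particular (`Level.eq_one_of_unipotent`) PerL's levels `Γ` contain no unipotent `≠ 1`.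

In PerL's regime `[L:ℚ] ≥ 4`, so the hypothesis `[L:ℚ] ≠ 2` is met; over an imaginary quadratic `L` it fails and so
does the conclusion (`Proofs/LandherrIsotropy.lean`: `h ≅ ⟨1,-1,-det h⟩` has the unipotent isometries of a hyperbolic
plane).  Pure proof over landed modules; nothing cited or posited; closures are the standard trio.
-/

noncomputable section

open scoped Matrix
open NumberField
open Literature.AlgebraicGeometry.ShimuraVarieties

namespace HodgeCM

/-! ## §1. Complex conjugation as the `star` of a CM field -/

namespace CMField

/-- **Scoped instance**: the CM field `L` as a `StarRing` with `star = conjRingHomK L` (complex conjugation, the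
non-trivial automorphism of `L/L⁺`).  Activate with `open HodgeCM.CMField`. -/
scoped instance instStarRing (L : CMField) : StarRing L where
  star := conjRingHomK L
  star_involutive := conjRingHomK_conjRingHomK L
  star_mul a b := by
    change conjRingHomK L (a * b) = conjRingHomK L b * conjRingHomK L a
    rw [map_mul, mul_comm]
  star_add a b := map_add (conjRingHomK L) a b

/-- (Ported verbatim from the HodgeCMPerL package; no docstring in the source.) -/
theorem star_def (L : CMField) (x : L) : star x = conjRingHomK L x := rfl

/-- `starRingEnd L = conjRingHomK L`. -/
theorem starRingEnd_eq (L : CMField) : starRingEnd L = conjRingHomK L :=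
  RingHom.ext fun x => by rw [starRingEnd_apply, star_def]

end CMField

open CMField

/-! ## §2. PerL's `h` as a Mathlib sesquilinear form -/

namespace HermSpace3

open PerL34.Doubling (Sesq isom godementDatum)
open PerL34.RallisIP (Anisotropic)

variable {L : CMField} {ι₁ : L →+* ℂ}

/-- **`h` as a sesquilinear form** `(Fin 3 → L) →ₗ⋆[L] (Fin 3 → L) →ₗ[L] L` (conjugate-linear in the first variable,
Mathlib's and pv05's convention): `(x, y) ↦ ⟪x, y⟫_{Hm} = Σ σ(xᵢ) Hmᵢⱼ yⱼ`. -/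
def sesq (V : HermSpace3 L ι₁) : Sesq L (Fin 3 → L) :=
  LinearMap.mk₂'ₛₗ (starRingEnd L) (RingHom.id L) (fun x y => hermForm (conjRingHomK L) V.Hm x y)
    (fun x x' y => by
      simp only [hermForm]
      rw [show (⇑(conjRingHomK L) ∘ (x + x')) = (⇑(conjRingHomK L) ∘ x) + (⇑(conjRingHomK L) ∘ x') from
        funext fun i => map_add _ _ _, add_dotProduct])
    (fun c x y => by
      simp only [hermForm, starRingEnd_eq, smul_eq_mul]
      rw [show (⇑(conjRingHomK L) ∘ (c • x)) = conjRingHomK L c • (⇑(conjRingHomK L) ∘ x) from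
        funext fun i => map_mul _ _ _, smul_dotProduct, smul_eq_mul])
    (fun x y y' => by simp only [hermForm, Matrix.mulVec_add, dotProduct_add])
    (fun c x y => by simp only [hermForm, Matrix.mulVec_smul, dotProduct_smul, RingHom.id_apply])

/-- (Ported verbatim from the HodgeCMPerL package; no docstring in the source.) -/
@[simp] theorem sesq_apply (V : HermSpace3 L ι₁) (x y : Fin 3 → L) :
    V.sesq x y = hermForm (conjRingHomK L) V.Hm x y := rfl

/-- pv05's `Anisotropic` for `V.sesq` is the negation of `V.IsIsotropic`. -/
theorem anisotropic_sesq_iff_not_isIsotropic (V : HermSpace3 L ι₁) : Anisotropic V.sesq ↔ ¬ V.IsIsotropic := by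
  simp only [Anisotropic, sesq_apply, IsIsotropic, not_exists, not_and]
  exact ⟨fun h x hx h0 => hx (h x h0), fun h x h0 => by by_contra hx; exact h x hx h0⟩

/-- **`h` is anisotropic (pv05's sense) iff `[L:ℚ] ≠ 2`.** -/
theorem anisotropic_sesq_iff (V : HermSpace3 L ι₁) : Anisotropic V.sesq ↔ Module.finrank ℚ L ≠ 2 := by
  rw [anisotropic_sesq_iff_not_isIsotropic, isIsotropic_iff_finrank_eq_two]

/-- In particular in PerL's regime (`[L:ℚ] ≠ 2`) `h` is anisotropic. -/
theorem anisotropic_sesq (V : HermSpace3 L ι₁) (hL : Module.finrank ℚ L ≠ 2) : Anisotropic V.sesq :=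
  (anisotropic_sesq_iff V).mpr hL

/-! ## §3. The dictionary `GL₃(L) ↔ (L³ ≃ₗ L³)` and `unitaryGroup σ Hm ↔ isom V.sesq` -/

section dictionary

variable {n : Type} [DecidableEq n]

/-- `σ ∘ eᵢ = eᵢ` for the standard basis vectors. -/
theorem comp_single_one (σ : L →+* L) (i : n) : (σ ∘ Pi.single i (1 : L)) = Pi.single i 1 := by
  funext k
  by_cases hk : k = i
  · subst hk; simp
  · simp [hk]

variable [Fintype n]

/-- The Gram matrix entries are values of the form: `⟪eᵢ, eⱼ⟫_A = Aᵢⱼ`. -/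
theorem hermForm_single_single (σ : L →+* L) (A : Matrix n n L) (i j : n) :
    hermForm σ A (Pi.single i 1) (Pi.single j 1) = A i j := by
  unfold hermForm
  rw [comp_single_one, single_one_dotProduct, Matrix.mulVec_single_one]
  rfl

/-- **A Gram matrix is determined by its form.** -/
theorem hermForm_injective (σ : L →+* L) {A B : Matrix n n L}
    (h : ∀ x y : n → L, hermForm σ A x y = hermForm σ B x y) : A = B := by
  ext i j
  rw [← hermForm_single_single σ A i j, ← hermForm_single_single σ B i j, h]

variable (L n)

/-- `GL n L ≃* ((n → L) ≃ₗ[L] (n → L))`, `g ↦ (x ↦ g x)` (Mathlib's `GeneralLinearGroup.toLin` followed by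
`LinearMap.GeneralLinearGroup.generalLinearEquiv`). -/
def glEquiv : GL n L ≃* ((n → L) ≃ₗ[L] (n → L)) :=
  Matrix.GeneralLinearGroup.toLin.trans (LinearMap.GeneralLinearGroup.generalLinearEquiv L (n → L))

variable {L n}

/-- (Ported verbatim from the HodgeCMPerL package; no docstring in the source.) -/
theorem glEquiv_toLinearMap (g : GL n L) :
    ((glEquiv L n g : (n → L) ≃ₗ[L] (n → L)) : (n → L) →ₗ[L] (n → L)) =
      Matrix.toLinAlgEquiv' (g : Matrix n n L) :=
  LinearMap.ext fun _ => rfl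

/-- (Ported verbatim from the HodgeCMPerL package; no docstring in the source.) -/
@[simp] theorem glEquiv_apply (g : GL n L) (x : n → L) : glEquiv L n g x = (g : Matrix n n L) *ᵥ x := by
  change ((glEquiv L n g : (n → L) ≃ₗ[L] (n → L)) : (n → L) →ₗ[L] (n → L)) x = _
  rw [glEquiv_toLinearMap, Matrix.toLinAlgEquiv'_apply]

end dictionary

/-- **The two unitary groups agree**: `x ↦ g x` is an isometry of `V.sesq` iff `ᵗ(σg) · Hm · g = Hm`, i.e. iff
`g ∈ unitaryGroup σ Hm` (the vendored matrix group in which `Level V` lives). -/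
theorem mem_isom_sesq_iff (V : HermSpace3 L ι₁) (g : GL (Fin 3) L) :
    glEquiv L (Fin 3) g ∈ isom V.sesq ↔ g ∈ unitaryGroup (conjRingHomK L) V.Hm := by
  rw [PerL34.Doubling.mem_isom_iff, mem_unitaryGroup_iff]
  simp only [sesq_apply, glEquiv_apply, LandherrIsotropy.hermForm_mulVec_mulVec]
  exact ⟨fun h => hermForm_injective (conjRingHomK L) h, fun h x y => by rw [h]⟩

/-- `isom V.sesq` is the image of `unitaryGroup σ Hm` under the dictionary. -/
theorem isom_sesq_eq_map (V : HermSpace3 L ι₁) :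
    isom V.sesq = (unitaryGroup (conjRingHomK L) V.Hm).map (glEquiv L (Fin 3)).toMonoidHom := by
  ext f
  rw [Subgroup.mem_map_equiv, ← mem_isom_sesq_iff, MulEquiv.apply_symm_apply]

/-- **`U(V₃, h)(L₀)` in the two languages**: `unitaryGroup σ Hm ≃* isom V.sesq`, `g ↦ (x ↦ g x)`. -/
def unitaryGroupEquivIsom (V : HermSpace3 L ι₁) : unitaryGroup (conjRingHomK L) V.Hm ≃* isom V.sesq :=
  ((glEquiv L (Fin 3)).subgroupMap (unitaryGroup (conjRingHomK L) V.Hm)).trans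
    (MulEquiv.subgroupCongr (isom_sesq_eq_map V).symm)

/-- (Ported verbatim from the HodgeCMPerL package; no docstring in the source.) -/
@[simp] theorem unitaryGroupEquivIsom_apply (V : HermSpace3 L ι₁) (g : unitaryGroup (conjRingHomK L) V.Hm) :
    ((unitaryGroupEquivIsom V g : isom V.sesq) : (Fin 3 → L) ≃ₗ[L] (Fin 3 → L)) = glEquiv L (Fin 3) g := rfl

/-! ## §4. Godement's anisotropy condition for `G_U = U(V₃, h)` -/

/-- **KERNEL: Godement's anisotropy condition holds for PerL's `G_U`** (`[L:ℚ] ≠ 2`): no element `≠ 1` of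
`U(V₃,h)(L₀) = isom V.sesq` is unipotent — the `anisotropic` field of the Godement datum of `U(V₃, h)` with any
compactness proposition `Q`. -/
theorem godement_anisotropic (V : HermSpace3 L ι₁) (hL : Module.finrank ℚ L ≠ 2) (Q : Prop) :
    (godementDatum V.sesq Q).anisotropic :=
  PerL34.Doubling.godementDatum_anisotropic V.sesq (anisotropic_sesq V hL) Q

/-- **PRINT + KERNEL ⇒ `[G_U]` compact**: Godement's Thm 4 for the datum of `U(V₃, h)` (a HYPOTHESIS — the printed
theorem is never asserted in this package) yields the consumer's compactness proposition `Q` for PerL's `G_U`. -/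
theorem compact_of_godement_thm4 (V : HermSpace3 L ι₁) (hL : Module.finrank ℚ L ≠ 2) (Q : Prop)
    (thm4 : (godementDatum V.sesq Q).Godement_Thm4) : Q :=
  PerL34.Doubling.compact_of_godement V.sesq (anisotropic_sesq V hL) Q thm4

/-- Nilpotency of `g − 1` is the same in `M₃(L)` and in `End_L(L³)`. -/
theorem isNilpotent_glEquiv_sub_one_iff (g : GL (Fin 3) L) :
    IsNilpotent (((glEquiv L (Fin 3) g : (Fin 3 → L) ≃ₗ[L] (Fin 3 → L)) : (Fin 3 → L) →ₗ[L] (Fin 3 → L)) - 1) ↔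
      IsNilpotent ((g : Matrix (Fin 3) (Fin 3) L) - 1) := by
  have h : ((glEquiv L (Fin 3) g : (Fin 3 → L) ≃ₗ[L] (Fin 3 → L)) : (Fin 3 → L) →ₗ[L] (Fin 3 → L)) - 1 =
      Matrix.toLinAlgEquiv' ((g : Matrix (Fin 3) (Fin 3) L) - 1) := by
    rw [map_sub, map_one, glEquiv_toLinearMap]
  rw [h]
  exact IsNilpotent.map_iff Matrix.toLinAlgEquiv'.injective

/-- **No unipotents in `U(V₃, h)(L₀)`, matrix form.**  If `[L:ℚ] ≠ 2`, every `g ∈ unitaryGroup σ Hm` with `g − 1`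
nilpotent is `1` (Godement's anisotropy of `G_U`, in the package's native language). -/
theorem eq_one_of_unipotent (V : HermSpace3 L ι₁) (hL : Module.finrank ℚ L ≠ 2) {g : GL (Fin 3) L}
    (hg : g ∈ unitaryGroup (conjRingHomK L) V.Hm) (hn : IsNilpotent ((g : Matrix (Fin 3) (Fin 3) L) - 1)) :
    g = 1 := by
  have h1 : glEquiv L (Fin 3) g = 1 :=
    PerL34.Doubling.eq_one_of_unipotent V.sesq (anisotropic_sesq V hL) ((mem_isom_sesq_iff V g).mpr hg)
      ((isNilpotent_glEquiv_sub_one_iff g).mpr hn)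
  exact (glEquiv L (Fin 3)).injective (by rw [h1, map_one])

/-- The converse bookkeeping: `1` is of course unipotent (`1 − 1 = 0`), so `eq_one_of_unipotent` is sharp as an
implication; stated as an iff on the unitary group. -/
theorem unipotent_iff_eq_one (V : HermSpace3 L ι₁) (hL : Module.finrank ℚ L ≠ 2) {g : GL (Fin 3) L}
    (hg : g ∈ unitaryGroup (conjRingHomK L) V.Hm) :
    IsNilpotent ((g : Matrix (Fin 3) (Fin 3) L) - 1) ↔ g = 1 :=
  ⟨eq_one_of_unipotent V hL hg, fun h => by rw [h, Units.val_one, sub_self]; exact IsNilpotent.zero⟩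

end HermSpace3

/-- **PerL's levels contain no unipotent element `≠ 1`** (`[L:ℚ] ≠ 2`): for a `Level V` (a torsion-free congruence
subgroup `Γ ≤ U(V₃,h)(L₀)`, `CM/Basic.lean`), every `γ ∈ Γ` with `γ − 1` nilpotent is `1`.  (With torsion-freeness
this is the semisimplicity of all of `Γ` used for the smooth compact ball quotients `Γ\𝔹²`.) -/
theorem Level.eq_one_of_unipotent {L : CMField} {ι₁ : L →+* ℂ} {V : HermSpace3 L ι₁} (Λ : Level V)
    (hL : Module.finrank ℚ L ≠ 2) {γ : GL (Fin 3) L} (hγ : γ ∈ Λ.Γ)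
    (hn : IsNilpotent ((γ : Matrix (Fin 3) (Fin 3) L) - 1)) : γ = 1 :=
  HermSpace3.eq_one_of_unipotent V hL (Λ.isCongruence.1 hγ) hn

end HodgeCM

end
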